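import Summits.ValiantsHypothesis.ValiantsHypothesis.Theorems.BarrierLeverDefinableEquationsBoolSumComponents

/-!
# Crux `BarrierLever.DefinableEquations` (stmt-ValiantsHypothesis-8745) / `SingleSizeEquations`
# (8749) — WEIGHT COMPONENTS OF BOOLEAN SUMS ARE BOOLEAN SUMS, II: the Fourier witness

Main theorem of the toolkit begun in `…BoolSumComponents.lean` (§1 block splitting, §2 bit products
and the twist, §3 torus scaling):

THEOREM (`exists_boolSum_eq_weightedHomogeneousComponent`).  For a finite index type `ι`, a weight
`W : ι → ℕ`, a Boolean-sum datum `H ∈ ℂ[ι ⊕ Fin q]`, and `L J : ℕ` with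
`weightedTotalDegree W (boolSum H) < 2^L` and `J < 2^L`, there is `H' ∈ ℂ[ι ⊕ Fin (q + L)]` with

  `boolSum H' = weightedHomogeneousComponent W J (boolSum H)`,
  `L(H') ≤ L(H) + |ι| (3L + 1) + 3L + 2`,   `deg H' ≤ deg H · (L + 1) + L`.

The witness (`fourierWitness`): `H'(c, e, u) = 2^{-L} · tw(ζ^{-J}) · H((tw(ζ^{W m}) c_m)_m, e)` with
`ζ = exp(2πi/2^L)` and `tw` the twist in the `L` new Boolean variables `u`; at a Boolean point
`tw(z) = z^{k(u)}`, so the Boolean sum over `u` is the discrete Fourier inversion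
`2^{-L} Σ_{k<2^L} ζ^{-Jk} E(ζ^{kW} c) = E_J(c)` (`boolSum_fourierWitness`; orthogonality
`sum_bitPow_one` / `sum_bitPow_eq_zero`).  ONE copy of `H` is used: a level-`a` witness yields
level-`O(a)` isobaric components, whereas plain interpolation would cost a factor `deg_W E`, which
is `N^{Θ(a n)}` for the torus weights of the crux.  Consumed by `…DefinableEquationsIsobaric.lean`.
No named facts; elementary.  References: [Burgisser2000] §2.1, Rem. 2.7; [ForbesShpilkaVolk2018]
Def. 1 (frame).
-/

-- layout Summits/ValiantsHypothesis/ValiantsHypothesis forces the duplicated namespace component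
set_option linter.dupNamespace false

noncomputable section

open MvPolynomial

namespace Summit.ValiantsHypothesis.ValiantsHypothesis.Theorems.BarrierLever.BoolSumComponents

open Literature.Computability.AlgebraicComplexity
open Summit.ValiantsHypothesis.ValiantsHypothesis.Theorems.BarrierLever.SuccinctHittingSetsForVP

variable {ι : Type*} {q : ℕ}

/-! ## The root of unity and the witness -/

/-- `ζ_L = exp(2πi / 2^L)`, a primitive `2^L`-th root of unity. [folklore] -/
def zeta (L : ℕ) : ℂ := Complex.exp (2 * Real.pi * Complex.I / ((2 ^ L : ℕ) : ℂ))

/-- `ζ_L` is a primitive `2^L`-th root of unity. [folklore] -/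
theorem zeta_isPrimitiveRoot (L : ℕ) : IsPrimitiveRoot (zeta L) (2 ^ L) :=
  Complex.isPrimitiveRoot_exp (2 ^ L) (pow_ne_zero L two_ne_zero)

/-- `ζ_L^{2^L} = 1`. [folklore] -/
theorem zeta_pow (L : ℕ) : zeta L ^ 2 ^ L = 1 := (zeta_isPrimitiveRoot L).pow_eq_one

/-- `ζ_L ≠ 0`. [folklore] -/
theorem zeta_ne_zero (L : ℕ) : zeta L ≠ 0 :=
  (zeta_isPrimitiveRoot L).ne_zero (pow_ne_zero L two_ne_zero)

/-- The substitution `c_m ↦ tw(ζ^{W m}) · c_m` (Boolean block `e` untouched). [folklore] -/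
def scaleSubst (W : ι → ℕ) (L : ℕ) : ι ⊕ Fin q → MvPolynomial ((ι ⊕ Fin q) ⊕ Fin L) ℂ :=
  Sum.elim (fun m => twist (zeta L ^ W m) * X (Sum.inl (Sum.inl m)))
    (fun j => X (Sum.inl (Sum.inr j)))

/-- The Fourier core `2^{-L} · tw(ζ^{-J}) · H((tw(ζ^{W m}) c_m)_m, e)` on the split variable type.
[folklore] -/
def fourierCore (W : ι → ℕ) (H : MvPolynomial (ι ⊕ Fin q) ℂ) (L J : ℕ) :
    MvPolynomial ((ι ⊕ Fin q) ⊕ Fin L) ℂ :=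
  C ((2 ^ L : ℂ)⁻¹) * (twist ((zeta L)⁻¹ ^ J) * aeval (scaleSubst W L) H)

/-- **The Fourier witness** `H' ∈ ℂ[ι ⊕ Fin (q + L)]` of the `J`-th `W`-isobaric component of
`boolSum H`. [folklore] -/
def fourierWitness (W : ι → ℕ) (H : MvPolynomial (ι ⊕ Fin q) ℂ) (L J : ℕ) :
    MvPolynomial (ι ⊕ Fin (q + L)) ℂ :=
  rename (blockEquiv ι q L) (fourierCore W H L J)

/-! ## The Boolean sum of the witness -/

section sum

variable (W : ι → ℕ) (H : MvPolynomial (ι ⊕ Fin q) ℂ) (L J : ℕ)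

/-- Scalars pass through Boolean sums. [folklore] -/
theorem boolSum_C_mul (a : ℂ) (P : MvPolynomial (ι ⊕ Fin q) ℂ) :
    boolSum (C a * P) = C a * boolSum P := by
  unfold boolSum
  rw [Finset.mul_sum]
  refine Finset.sum_congr rfl fun e _ => ?_
  rw [map_mul, aeval_C, algebraMap_eq]

/-- At a Boolean point `u` of the new block, the scaled substitution becomes the diagonal scaling
`c_m ↦ s_u^{W m} c_m` with `s_u = ζ^{k(u)}` (`= bitPow u ζ`). [folklore] -/
theorem setBits_aeval_scaleSubst (u : Fin L → Bool) :
    setBits u (aeval (scaleSubst (q := q) W L) H) =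
      aeval (Sum.elim (fun m => rename (Sum.inl : ι → ι ⊕ Fin q)
        (C (bitPow u (zeta L) ^ W m) * X m)) (fun j => X (Sum.inr j))) H := by
  unfold setBits
  rw [← AlgHom.comp_apply, comp_aeval]
  have hfun : (fun v => aeval (Sum.elim X fun l => if u l then (1 : MvPolynomial (ι ⊕ Fin q) ℂ) else 0)
        (scaleSubst (q := q) W L v)) =
      Sum.elim (fun m => rename (Sum.inl : ι → ι ⊕ Fin q) (C (bitPow u (zeta L) ^ W m) * X m))
        (fun j => X (Sum.inr j)) := by
    funext v
    rcases v with m | j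
    · simp only [scaleSubst, Sum.elim_inl, map_mul, aeval_X, rename_X, rename_C]
      have h := setBits_twist (ι := ι) (q := q) u (zeta L ^ W m)
      unfold setBits at h
      rw [h, bitPow_pow]
    · simp only [scaleSubst, Sum.elim_inr, aeval_X, Sum.elim_inl]
  rw [hfun]

/-- The Boolean sum over the OLD block at a fixed new bit vector `u`:
`Σ_j 2^{-L} · r_j^{k(u)} · E_j` with `r_j = ζ^{-J} ζ^{j}`. [folklore] -/
theorem boolSum_setBits_fourierCore (u : Fin L → Bool) :
    boolSum (setBits u (fourierCore W H L J)) =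
      ∑ j ∈ Finset.range (weightedTotalDegree W (boolSum H) + 1),
        C ((2 ^ L : ℂ)⁻¹ * bitPow u ((zeta L)⁻¹ ^ J * zeta L ^ j)) *
          weightedHomogeneousComponent W j (boolSum H) := by
  have hcore : setBits u (fourierCore W H L J) =
      C ((2 ^ L : ℂ)⁻¹) * (C (bitPow u ((zeta L)⁻¹ ^ J)) *
        aeval (Sum.elim (fun m => rename (Sum.inl : ι → ι ⊕ Fin q)
          (C (bitPow u (zeta L) ^ W m) * X m)) (fun j => X (Sum.inr j))) H) := by
    rw [← setBits_aeval_scaleSubst, ← setBits_twist (ι := ι) (q := q) u]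
    unfold fourierCore setBits
    rw [map_mul, map_mul, aeval_C, algebraMap_eq]
  rw [hcore, boolSum_C_mul, boolSum_C_mul, boolSum_aeval_inl, aeval_scale_eq_sum,
    Finset.mul_sum, Finset.mul_sum]
  refine Finset.sum_congr rfl fun j _ => ?_
  rw [← bitPow_pow, bitPow_mul, map_mul, map_mul]
  ring

/-- The character sum at frequency `j − J`: `Σ_u r_j^{k(u)}` is `2^L` at `j = J` and `0` at
`j ≠ J` (`j, J < 2^L`). [folklore] -/
theorem sum_bitPow_freq {j : ℕ} (hj : j < 2 ^ L) (hJ : J < 2 ^ L) :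
    ∑ u : Fin L → Bool, bitPow u ((zeta L)⁻¹ ^ J * zeta L ^ j) =
      if j = J then (2 ^ L : ℂ) else 0 := by
  have hζ := zeta_isPrimitiveRoot L
  have hζ0 := zeta_ne_zero L
  split_ifs with h
  · subst h
    rw [← mul_pow, inv_mul_cancel₀ hζ0, one_pow]
    exact sum_bitPow_one
  · refine sum_bitPow_eq_zero ?_ ?_
    · rw [mul_pow, pow_right_comm _ J, pow_right_comm _ j, inv_pow, zeta_pow, inv_one, one_pow,
        one_pow, one_mul]
    · intro h1
      apply h
      refine hζ.pow_inj hj hJ ?_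
      have : zeta L ^ J * ((zeta L)⁻¹ ^ J * zeta L ^ j) = zeta L ^ J := by rw [h1, mul_one]
      rw [← mul_assoc, ← mul_pow, mul_inv_cancel₀ hζ0, one_pow, one_mul] at this
      exact this

/-- **The Boolean sum of the Fourier witness is the `J`-th `W`-isobaric component of `boolSum H`**
(`deg_W (boolSum H) < 2^L`, `J < 2^L`). [folklore] -/
theorem boolSum_fourierWitness (hK : weightedTotalDegree W (boolSum H) < 2 ^ L) (hJ : J < 2 ^ L) :
    boolSum (fourierWitness W H L J) = weightedHomogeneousComponent W J (boolSum H) := by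
  classical
  set K := weightedTotalDegree W (boolSum H) with hKdef
  rw [fourierWitness, boolSum_rename_blockEquiv]
  simp_rw [boolSum_setBits_fourierCore]
  rw [Finset.sum_comm]
  have hterm : ∀ j ∈ Finset.range (K + 1),
      ∑ u : Fin L → Bool, C ((2 ^ L : ℂ)⁻¹ * bitPow u ((zeta L)⁻¹ ^ J * zeta L ^ j)) *
          weightedHomogeneousComponent W j (boolSum H) =
        if j = J then weightedHomogeneousComponent W J (boolSum H) else 0 := by
    intro j hj
    have hjM : j < 2 ^ L := lt_of_le_of_lt (Nat.lt_succ_iff.mp (Finset.mem_range.mp hj)) hK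
    rw [← Finset.sum_mul, ← map_sum, ← Finset.mul_sum, sum_bitPow_freq L J hjM hJ]
    split_ifs with h
    · subst h
      rw [inv_mul_cancel₀ (pow_ne_zero L (two_ne_zero)), C_1, one_mul]
    · rw [mul_zero, C_0, zero_mul]
  rw [Finset.sum_congr rfl hterm, Finset.sum_ite_eq' (Finset.range (K + 1)) J]
  split_ifs with hmem
  · rfl
  · exact (weightedHomogeneousComponent_eq_zero J _
      (by have := Finset.mem_range.not.mp hmem; omega)).symm

end sum

/-! ## Size and degree of the witness -/

section size

variable (W : ι → ℕ) (H : MvPolynomial (ι ⊕ Fin q) ℂ) (L J : ℕ)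

/-- `L(H') ≤ L(H) + |ι| (3L + 1) + 3L + 2`: one copy of `H`, one twist per coefficient variable,
one more twist and a scalar. [cite: Burgisser2000, Rem. 2.7] -/
theorem complexity_fourierWitness_le [Fintype ι] :
    complexity (fourierWitness W H L J) ≤
      complexity H + Fintype.card ι * (3 * L + 1) + 3 * L + 2 := by
  unfold fourierWitness fourierCore
  refine (complexity_rename_le_holds' _ _).trans ?_
  have hsub : complexity (aeval (scaleSubst (q := q) W L) H) ≤
      complexity H + Fintype.card ι * (3 * L + 1) := by
    refine (complexity_aeval_le _ _).trans (Nat.add_le_add_left ?_ _)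
    rw [Fintype.sum_sum_type]
    have h0 : ∑ j : Fin q, complexity (scaleSubst (q := q) W L (Sum.inr j)) = 0 :=
      Finset.sum_eq_zero fun j _ => by
        simp only [scaleSubst, Sum.elim_inr]; exact complexity_X_holds _
    rw [h0, add_zero]
    calc ∑ m : ι, complexity (scaleSubst (q := q) W L (Sum.inl m))
        ≤ ∑ _m : ι, (3 * L + 1) := Finset.sum_le_sum fun m _ => by
          simp only [scaleSubst, Sum.elim_inl]
          calc complexity (twist (zeta L ^ W m) * X (Sum.inl (Sum.inl m)) :
                MvPolynomial ((ι ⊕ Fin q) ⊕ Fin L) ℂ)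
              ≤ complexity (twist (ι := ι) (q := q) (L := L) (zeta L ^ W m)) +
                  complexity (X (Sum.inl (Sum.inl m)) : MvPolynomial ((ι ⊕ Fin q) ⊕ Fin L) ℂ) + 1 :=
                complexity_mul_le_holds _ _
            _ ≤ 3 * L + 0 + 1 :=
                Nat.add_le_add_right (Nat.add_le_add (complexity_twist_le _)
                  (complexity_X_holds _).le) 1
            _ = 3 * L + 1 := by ring
      _ = Fintype.card ι * (3 * L + 1) := by
          rw [Finset.sum_const, Finset.card_univ, smul_eq_mul]
  calc complexity (C ((2 ^ L : ℂ)⁻¹) * (twist ((zeta L)⁻¹ ^ J) * aeval (scaleSubst W L) H))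
      ≤ complexity (C ((2 ^ L : ℂ)⁻¹) : MvPolynomial ((ι ⊕ Fin q) ⊕ Fin L) ℂ) +
          complexity (twist ((zeta L)⁻¹ ^ J) * aeval (scaleSubst (q := q) W L) H) + 1 :=
        complexity_mul_le_holds _ _
    _ ≤ 0 + (3 * L + (complexity H + Fintype.card ι * (3 * L + 1)) + 1) + 1 := by
        refine Nat.add_le_add_right (Nat.add_le_add (complexity_C_holds _).le
          ((complexity_mul_le_holds _ _).trans (Nat.add_le_add_right
            (Nat.add_le_add (complexity_twist_le _) hsub) 1))) 1
    _ = complexity H + Fintype.card ι * (3 * L + 1) + 3 * L + 2 := by ring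

/-- `deg H' ≤ deg H · (L + 1) + L`. [folklore] -/
theorem totalDegree_fourierWitness_le :
    (fourierWitness W H L J).totalDegree ≤ H.totalDegree * (L + 1) + L := by
  unfold fourierWitness fourierCore
  refine (totalDegree_rename_le _ _).trans ?_
  refine (totalDegree_mul _ _).trans ?_
  rw [totalDegree_C, zero_add]
  refine (totalDegree_mul _ _).trans ?_
  have hsub : (aeval (scaleSubst (q := q) W L) H).totalDegree ≤ H.totalDegree * (L + 1) := by
    rw [show aeval (scaleSubst (q := q) W L) H = bind₁ (scaleSubst W L) H from rfl]
    refine Literature.Barriers.ValiantsHypothesis.FSV2018.totalDegree_bind₁_le_mul _ (L + 1)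
      (fun v => ?_) H
    rcases v with m | j
    · simp only [scaleSubst, Sum.elim_inl]
      refine (totalDegree_mul _ _).trans ?_
      rw [totalDegree_X]
      exact Nat.add_le_add_right (totalDegree_twist_le _) 1
    · simp only [scaleSubst, Sum.elim_inr, totalDegree_X]
      omega
  calc (twist ((zeta L)⁻¹ ^ J) : MvPolynomial ((ι ⊕ Fin q) ⊕ Fin L) ℂ).totalDegree +
        (aeval (scaleSubst (q := q) W L) H).totalDegree
      ≤ L + H.totalDegree * (L + 1) := Nat.add_le_add (totalDegree_twist_le _) hsub
    _ = H.totalDegree * (L + 1) + L := by ring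

end size

/-! ## The theorem -/

/-- **Weight components of Boolean sums are Boolean sums.**  For a finite index type `ι`, a weight
`W : ι → ℕ`, `H ∈ ℂ[ι ⊕ Fin q]` and `L J : ℕ` with `deg_W (boolSum H) < 2^L` and `J < 2^L`, the
`J`-th `W`-isobaric component of `boolSum H` is `boolSum H'` for some `H' ∈ ℂ[ι ⊕ Fin (q + L)]` of
size `≤ L(H) + |ι|(3L+1) + 3L + 2` and degree `≤ deg H · (L+1) + L`.
[cite: Burgisser2000, §2.1 and Rem. 2.7] -/
theorem exists_boolSum_eq_weightedHomogeneousComponent [Fintype ι] (W : ι → ℕ)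
    (H : MvPolynomial (ι ⊕ Fin q) ℂ) {L J : ℕ}
    (hK : weightedTotalDegree W (boolSum H) < 2 ^ L) (hJ : J < 2 ^ L) :
    ∃ H' : MvPolynomial (ι ⊕ Fin (q + L)) ℂ,
      boolSum H' = weightedHomogeneousComponent W J (boolSum H) ∧
      complexity H' ≤ complexity H + Fintype.card ι * (3 * L + 1) + 3 * L + 2 ∧
      H'.totalDegree ≤ H.totalDegree * (L + 1) + L :=
  ⟨fourierWitness W H L J, boolSum_fourierWitness W H L J hK hJ,
    complexity_fourierWitness_le W H L J, totalDegree_fourierWitness_le W H L J⟩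

end Summit.ValiantsHypothesis.ValiantsHypothesis.Theorems.BarrierLever.BoolSumComponents

end
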